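import Literature.Geometry.Riemannian.SphericalCylinderEntropyZonalJets
import Literature.Analysis.Calculus.LocalizedSmoothSeries
import Mathlib.Analysis.Calculus.ContDiff.WithLp
import HarnessLib

/-!
# Joint smoothness of the typed zonal heat kernel of `S⁴` and of the typed kernel on `ℝ⁶`

Topic `Literature/Geometry/Riemannian`; continuation of `SphericalCylinderEntropyZonalJets.lean`.
The typed zonal kernel `zonal τ s = ∑_k wt k τ · gegen k s` of route `SmoothPoincare4/CylinderEntropy`
(`= vol(S⁴) · H_{S⁴}` in the variable `s = ⟨z', p'⟩`) and the typed kernel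
`cylKernel p τ z = zonal τ ⟨z', p'⟩ · e^{-(z₅-p₅)²/4τ}` on `ℝ⁶` are GENUINELY SMOOTH:

* `contDiffAt_zonal_prod`, `contDiffOn_zonal_prod_smooth` — **`(τ, s) ↦ 𝔥(τ, s)` is `C^∞` on
  `(0, ∞) × ℝ`** (the tree's localized smooth-series theorem
  `Literature.Analysis.Calculus.contDiffAt_tsum_of_norm_iteratedFDeriv_le` on the ball of radius `τ₀/2`
  about `(τ₀, s₀)`, fed with the Gaussian majorants `norm_iteratedFDeriv_mode_le_exp` of ALL jets of the
  modes on `[τ₀/2, ∞) × [-R, R]`, `R = |s₀| + τ₀/2 + 1`);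
* `contDiff_zonal`, `contDiffAt_zonal_tau` — smoothness in each variable separately;
* `contDiffAt_cylKernel_prod`, `contDiffOn_cylKernel_prod`, `contDiff_cylKernel`,
  `contDiffAt_cylKernel_tau` — **the typed kernel is `C^∞` in `(τ, z) ∈ (0, ∞) × ℝ⁶`**, in particular
  `z ↦ cylKernel p τ z` is smooth on all of `ℝ⁶` (so on a neighbourhood of `N`) for every `τ > 0`:
  the regularity that makes the ambient derivatives `fderiv ℝ (cylKernel p τ)`,
  `iteratedFDeriv ℝ 2 (cylKernel p τ)` in Hamilton's Harnack quadratic form of the typed kernel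
  (crux `CylinderRungTwo`, stub `stub_hamiltonMonotonicity`) honest derivatives.

## References
* R. S. Hamilton, *A matrix Harnack estimate for the heat equation*, Comm. Anal. Geom. 1 (1993),
  113–126; *Monotonicity formulas for parabolic flows on manifolds*, ibid. 127–137.
* E. B. Davies, *Heat Kernels and Spectral Theory*, CUP 1989, Ch. 5.
-/

noncomputable section

open scoped BigOperators Topology ContDiff
open Filter Set Finset Literature.Geometry.Riemannian

namespace Literature.Geometry.Riemannian.SphericalCylinderEntropy

/-! ### Joint smoothness of the typed zonal kernel -/

/-- **`(τ, s) ↦ 𝔥(τ, s)` is `C^∞` at every point of `(0, ∞) × ℝ`.** [folklore] -/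
theorem contDiffAt_zonal_prod {a : ℝ × ℝ} (ha : 0 < a.1) :
    ContDiffAt ℝ ∞ (fun y : ℝ × ℝ => zonal y.1 y.2) a := by
  have hr : 0 < a.1 / 2 := half_pos ha
  set R : ℝ := |a.2| + a.1 / 2 + 1 with hRdef
  have hR : (1 : ℝ) ≤ R := by rw [hRdef]; linarith [abs_nonneg a.2]
  set g : ℕ → ℝ × ℝ → ℝ := fun k x => wt k (a + x).1 * gegen k (a + x).2 with hgdef
  have hg : ∀ k, ContDiff ℝ ∞ (g k) := fun k =>
    (contDiff_mode k).comp (contDiff_const.add contDiff_id)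
  have hb : ∀ (m : ℕ) (k : ℕ) (x : ℝ × ℝ), ‖x‖ ≤ a.1 / 2 →
      ‖iteratedFDeriv ℝ m (g k) x‖ ≤ (8 ^ m * (m.factorial : ℝ)) *
        (Real.exp (-((k : ℝ) * ((k : ℝ) + 3)) * (a.1 / 2)) * (4 ^ m * (512 * R)) ^ k) := by
    intro m k x hx
    have hshift : iteratedFDeriv ℝ m (g k) x =
        iteratedFDeriv ℝ m (fun y : ℝ × ℝ => wt k y.1 * gegen k y.2) (a + x) :=
      iteratedFDeriv_comp_add_left (f := fun y : ℝ × ℝ => wt k y.1 * gegen k y.2) m a x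
    rw [hshift]
    have hx1 : |x.1| ≤ a.1 / 2 := (norm_fst_le x).trans hx
    have hx2 : |x.2| ≤ a.1 / 2 := (norm_snd_le x).trans hx
    refine norm_iteratedFDeriv_mode_le_exp m k hR ?_ ?_
    · change a.1 / 2 ≤ a.1 + x.1
      linarith [neg_abs_le x.1]
    · change |a.2 + x.2| ≤ R
      rw [hRdef]
      linarith [abs_add_le a.2 x.2]
  have h := Literature.Analysis.Calculus.contDiffAt_tsum_of_norm_iteratedFDeriv_le (f := g) hr hg
    (fun m => summable_mode_majorant m hr (R := R) (by linarith)) hb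
  have hcomp : (fun y : ℝ × ℝ => zonal y.1 y.2) = (fun x => ∑' k, g k x) ∘ fun y => y - a := by
    funext y
    simp [hgdef, zonal]
  rw [hcomp]
  refine ContDiffAt.comp a ?_ (contDiffAt_id.sub contDiffAt_const)
  simpa using h

/-- **The typed zonal kernel is jointly smooth on `(0, ∞) × ℝ`.** [folklore] -/
theorem contDiffOn_zonal_prod_smooth :
    ContDiffOn ℝ ∞ (fun y : ℝ × ℝ => zonal y.1 y.2) (Set.Ioi 0 ×ˢ Set.univ) :=
  fun _ hy => (contDiffAt_zonal_prod hy.1).contDiffWithinAt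

/-- `s ↦ 𝔥(τ, s)` is smooth on `ℝ` for `τ > 0`. [folklore] -/
theorem contDiff_zonal {τ : ℝ} (hτ : 0 < τ) : ContDiff ℝ ∞ (zonal τ) := by
  rw [contDiff_iff_contDiffAt]
  intro s
  have h1 : ContDiffAt ℝ ∞ (fun y : ℝ × ℝ => zonal y.1 y.2) (τ, s) := contDiffAt_zonal_prod hτ
  have h2 : ContDiffAt ℝ ∞ (fun x : ℝ => ((τ, x) : ℝ × ℝ)) s := by fun_prop
  exact h1.comp s h2

/-- `τ ↦ 𝔥(τ, s)` is smooth on `(0, ∞)` for every real `s`. [folklore] -/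
theorem contDiffAt_zonal_tau {τ : ℝ} (hτ : 0 < τ) (s : ℝ) :
    ContDiffAt ℝ ∞ (fun τ' : ℝ => zonal τ' s) τ := by
  have h1 : ContDiffAt ℝ ∞ (fun y : ℝ × ℝ => zonal y.1 y.2) (τ, s) := contDiffAt_zonal_prod hτ
  have h2 : ContDiffAt ℝ ∞ (fun x : ℝ => ((x, s) : ℝ × ℝ)) τ := by fun_prop
  exact h1.comp τ h2

/-! ### Smoothness of the typed kernel on `ℝ⁶` -/

/-- **The typed kernel is jointly smooth in `(τ, z) ∈ (0, ∞) × ℝ⁶`** (in particular on a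
neighbourhood of `N`): `cylKernel p τ z = 𝔥(τ, ⟨z', p'⟩) · e^{-(z₅-p₅)²/4τ}`. [folklore] -/
theorem contDiffAt_cylKernel_prod (p : EuclideanSpace ℝ (Fin 6)) {q : ℝ × EuclideanSpace ℝ (Fin 6)}
    (hq : 0 < q.1) : ContDiffAt ℝ ∞ (fun q : ℝ × EuclideanSpace ℝ (Fin 6) => cylKernel p q.1 q.2) q := by
  have h1 : ContDiffAt ℝ ∞ (fun q : ℝ × EuclideanSpace ℝ (Fin 6) =>
      zonal q.1 (∑ i : Fin 5, q.2 (Fin.castSucc i) * p (Fin.castSucc i))) q := by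
    have hz := contDiffAt_zonal_prod
      (a := ((q.1, ∑ i : Fin 5, q.2 (Fin.castSucc i) * p (Fin.castSucc i)) : ℝ × ℝ)) hq
    have hmap : ContDiffAt ℝ ∞ (fun q : ℝ × EuclideanSpace ℝ (Fin 6) =>
        ((q.1, ∑ i : Fin 5, q.2 (Fin.castSucc i) * p (Fin.castSucc i)) : ℝ × ℝ)) q := by
      fun_prop
    exact hz.comp q hmap
  have h2 : ContDiffAt ℝ ∞ (fun q : ℝ × EuclideanSpace ℝ (Fin 6) =>
      Real.exp (-((q.2 5 - p 5) ^ 2) / (4 * q.1))) q := by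
    have hne : 4 * q.1 ≠ 0 := by positivity
    fun_prop (disch := exact hne)
  exact h1.mul h2

/-- The typed kernel is jointly smooth on `(0, ∞) × ℝ⁶`. [folklore] -/
theorem contDiffOn_cylKernel_prod (p : EuclideanSpace ℝ (Fin 6)) :
    ContDiffOn ℝ ∞ (fun q : ℝ × EuclideanSpace ℝ (Fin 6) => cylKernel p q.1 q.2)
      (Set.Ioi 0 ×ˢ Set.univ) :=
  fun _ hq => (contDiffAt_cylKernel_prod p hq.1).contDiffWithinAt

/-- **`z ↦ cylKernel p τ z` is smooth on all of `ℝ⁶`** for `τ > 0`. [folklore] -/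
theorem contDiff_cylKernel (p : EuclideanSpace ℝ (Fin 6)) {τ : ℝ} (hτ : 0 < τ) :
    ContDiff ℝ ∞ (cylKernel p τ) := by
  rw [contDiff_iff_contDiffAt]
  intro z
  have h1 := contDiffAt_cylKernel_prod p (q := (τ, z)) hτ
  have h2 : ContDiffAt ℝ ∞ (fun x : EuclideanSpace ℝ (Fin 6) => ((τ, x) : ℝ × EuclideanSpace ℝ (Fin 6))) z := by
    fun_prop
  exact h1.comp z h2

/-- `τ ↦ cylKernel p τ z` is smooth on `(0, ∞)`. [folklore] -/
theorem contDiffAt_cylKernel_tau (p z : EuclideanSpace ℝ (Fin 6)) {τ : ℝ} (hτ : 0 < τ) :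
    ContDiffAt ℝ ∞ (fun τ' : ℝ => cylKernel p τ' z) τ := by
  have h1 := contDiffAt_cylKernel_prod p (q := (τ, z)) hτ
  have h2 : ContDiffAt ℝ ∞ (fun x : ℝ => ((x, z) : ℝ × EuclideanSpace ℝ (Fin 6))) τ := by fun_prop
  exact h1.comp τ h2

end Literature.Geometry.Riemannian.SphericalCylinderEntropy

end
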